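import Mathlib
import Summits.ResolutionOfSingularities.ResolutionOfSingularities.Theorems.SyzygyFlatteningDefs
import Literature.AlgebraicGeometry.Resolution.TranscendenceDefect
import HarnessLib

/-!
# Syzygy-flattening tower: the residual transcendence degree drops under `(k, K) ↦ (k(X), K(X))`

Stub `stub_residueTrdeg_drop` of the crux `HigherRankTermination` (line `birth`, base-change line).

Situation: `v` is a real-valued valuation of `K` with valuation ring `O ⊇ k`, `w` a valuation of
`K(X)` extending `v` whose valuation ring `O'` contains the new ground field `k' = k(X)`, and `w`
has the *normal-form property*: every `y` with `w y ≤ 1` is congruent modulo `w < 1` to (the image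
of) some `a ∈ O`.  Then

* the inclusion `O → O'` is a local homomorphism, and the induced map of residue fields
  `κ(O) → κ(O')` is a *surjective* `k`-algebra homomorphism (normal form), so
  `tr.deg_k κ(O') ≤ tr.deg_k κ(O)` (`trdeg_le_of_surjective`);
* `k' = k(X)` is transcendental over `k` (`X` is transcendental over `K ⊇ k`), so
  `1 ≤ tr.deg_k k'`;
* the tower inequality `tr.deg_k k' + tr.deg_{k'} κ(O') ≤ tr.deg_k κ(O')` (`trdeg_add_le`)
  gives `tr.deg_{k'} κ(O') + 1 ≤ tr.deg_k κ(O)`, whence the claim when the latter is finite.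

This is the residue-field half of the classical statement that a value-transcendental Gauss
extension `K(X) / K` has `K(X)w = Kv` (Kuhlmann 2010, Lemma 2.5), measured over the enlarged
trivially valued ground field `k(X)` (Temkin 2013, §2.1: the invariant `F`).

Sources: Kuhlmann 2010, Lemma 2.5; Temkin 2013, §2.1; the transcendence-degree bookkeeping is
folklore.
-/

noncomputable section

-- single-problem summit: the doubled namespace component is forced
set_option linter.dupNamespace false

open scoped NNReal

namespace Summit.ResolutionOfSingularities.ResolutionOfSingularities.Theorems.SyzygyFlattening

open Literature.AlgebraicGeometry.Resolution

/-- Transcendence-degree bookkeeping: if `k'/k` is transcendental and `E → E'` is a surjective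
`k`-algebra map of fields compatible with a `k'`-structure on `E'`, then
`tr.deg_{k'} E' < tr.deg_k E` as natural numbers, provided `tr.deg_k E` is finite. [folklore] -/
theorem residueTrdeg_drop_toNat_trdeg_lt {k k' E E' : Type} [Field k] [Field k'] [Field E]
    [Field E'] [Algebra k k'] [Algebra k E] [Algebra k' E'] [Algebra k E'] [IsScalarTower k k' E']
    [Algebra.Transcendental k k'] (ψ : E →ₐ[k] E') (hψ : Function.Surjective ψ)
    (hfin : Algebra.trdeg k E < Cardinal.aleph0) :
    Cardinal.toNat (Algebra.trdeg k' E') < Cardinal.toNat (Algebra.trdeg k E) := by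
  obtain ⟨n, hn⟩ := Cardinal.lt_aleph0.1 hfin
  have h1 : Algebra.trdeg k k' + Algebra.trdeg k' E' ≤ Algebra.trdeg k E' := trdeg_add_le
  have h2 : Algebra.trdeg k E' ≤ Algebra.trdeg k E := trdeg_le_of_surjective ψ hψ
  have h3 : (1 : Cardinal) ≤ Algebra.trdeg k k' := Cardinal.one_le_iff_pos.2 (trdeg_pos k k')
  have h4 : 1 + Algebra.trdeg k' E' ≤ (n : Cardinal) :=
    calc 1 + Algebra.trdeg k' E' ≤ Algebra.trdeg k k' + Algebra.trdeg k' E' := by gcongr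
      _ ≤ Algebra.trdeg k E := h1.trans h2
      _ = n := hn
  have hfin' : Algebra.trdeg k' E' < Cardinal.aleph0 :=
    (le_add_self.trans h4).trans_lt Cardinal.natCast_lt_aleph0
  obtain ⟨m, hm⟩ := Cardinal.lt_aleph0.1 hfin'
  rw [hm] at h4
  rw [hm, hn, Cardinal.toNat_natCast, Cardinal.toNat_natCast]
  have h5 : 1 + m ≤ n := by exact_mod_cast h4
  omega

/-- **The residual transcendence degree drops under the base change `(k, K) ↦ (k(X), K(X))`.**
Let `v` be a real-valued valuation of `K` with ring `O ⊇ k`, `ζ ∈ O` with residue transcendental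
over `k`, `w` a valuation of `K(X)` extending `v` with `w(X - ζ) < 1` and the normal-form property
(every `y` with `w y ≤ 1` is `≡ a (mod w < 1)` for some `a ∈ O`), `O'` the ring of `w` and
`k' = k(X) ⊆ O'`.  Then `tr.deg_{k'} κ(O') < tr.deg_k κ(O)` whenever the latter is finite and
positive: the residue fields agree (`κ(O) → κ(O')` is onto by the normal form) while the ground
field has acquired the transcendental `X` (Kuhlmann 2010, Lemma 2.5: "`K(x)v = Kv`" for a
value-transcendental extension).
[cite: Kuhlmann2010, Lemma 2.5] -/
theorem stub_residueTrdeg_drop : ∀ (k K : Type) [Field k] [Field K] [Algebra k K]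
    (O : ValuationSubring K) (hk : ∀ c : k, algebraMap k K c ∈ O)
    (v : Valuation K ℝ≥0), (∀ x : K, v x ≤ 1 ↔ x ∈ O) →
    ∀ (ζ : K), ζ ∈ O → (∀ G : Polynomial k, G ≠ 0 → v (Polynomial.aeval ζ G) = 1) →
    ∀ (w : Valuation (RatFunc K) ℝ≥0), (∀ a : K, w (algebraMap K (RatFunc K) a) = v a) →
      w (RatFunc.X - algebraMap K (RatFunc K) ζ) < 1 →
      (∀ y : RatFunc K, w y ≤ 1 → ∃ a : K, v a ≤ 1 ∧ w (y - algebraMap K (RatFunc K) a) < 1) →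
    ∀ (O' : ValuationSubring (RatFunc K)), (∀ y : RatFunc K, w y ≤ 1 ↔ y ∈ O') →
    ∀ (k' : Type) [Field k'] [Algebra k k'] [Algebra k' (RatFunc K)] [IsScalarTower k k' (RatFunc K)],
      Set.range (algebraMap k' (RatFunc K)) =
        ((IntermediateField.adjoin k {(RatFunc.X : RatFunc K)} : IntermediateField k (RatFunc K)) :
          Set (RatFunc K)) →
    ∀ (hk' : ∀ g : k', algebraMap k' (RatFunc K) g ∈ O'),
      residueTrdeg k O hk < Cardinal.aleph0 → 0 < Cardinal.toNat (residueTrdeg k O hk) →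
      Cardinal.toNat (residueTrdeg k' O' hk') < Cardinal.toNat (residueTrdeg k O hk) := by
  intro k K _ _ _ O hk v hvO ζ _ _ w hwv _ hnf O' hwO' k' _ _ _ _ hrange hk' hfin _
  -- the `k`- and `k'`-algebra structures on `O`, `O'`
  letI : Algebra k O := algebraOfMem k O hk
  haveI : IsScalarTower k O K := isScalarTower_algebraOfMem k O hk
  letI : Algebra k' O' := algebraOfMem k' O' hk'
  haveI : IsScalarTower k' O' (RatFunc K) := isScalarTower_algebraOfMem k' O' hk'
  have hkO' : ∀ c : k, algebraMap k (RatFunc K) c ∈ O' := fun c => by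
    rw [IsScalarTower.algebraMap_apply k k' (RatFunc K)]
    exact hk' _
  letI : Algebra k O' := algebraOfMem k O' hkO'
  haveI : IsScalarTower k O' (RatFunc K) := isScalarTower_algebraOfMem k O' hkO'
  haveI : IsScalarTower k k' O' := IsScalarTower.of_algebraMap_eq fun c => Subtype.ext <| by
    show algebraMap k (RatFunc K) c = algebraMap k' (RatFunc K) (algebraMap k k' c)
    exact IsScalarTower.algebraMap_apply k k' (RatFunc K) c
  rw [residueTrdeg_eq O hk] at hfin ⊢
  rw [residueTrdeg_eq O' hk']
  -- `O`, `O'` are the integers of `v`, `w`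
  have hvInt : v.Integers O :=
    { hom_inj := Subtype.val_injective
      map_le_one := fun x => (hvO x).2 x.2
      exists_of_le_one := fun r hr => ⟨⟨r, (hvO r).1 hr⟩, rfl⟩ }
  have hwInt : w.Integers O' :=
    { hom_inj := Subtype.val_injective
      map_le_one := fun y => (hwO' y).2 y.2
      exists_of_le_one := fun r hr => ⟨⟨r, (hwO' r).1 hr⟩, rfl⟩ }
  -- the inclusion `O → O'` is a local `k`-algebra homomorphism
  have hOO' : ∀ x : O, algebraMap K (RatFunc K) x ∈ O' := fun x =>
    (hwO' _).1 (by rw [hwv]; exact (hvO x).2 x.2)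
  let f : O →ₐ[k] O' :=
    { toFun := fun x => ⟨algebraMap K (RatFunc K) x, hOO' x⟩
      map_one' := Subtype.ext (by simp)
      map_mul' := fun x y => Subtype.ext (by simp)
      map_zero' := Subtype.ext (by simp)
      map_add' := fun x y => Subtype.ext (by simp)
      commutes' := fun c => Subtype.ext <| by
        show algebraMap K (RatFunc K) (algebraMap k K c) = algebraMap k (RatFunc K) c
        exact (IsScalarTower.algebraMap_apply k K (RatFunc K) c).symm }
  have hf_apply : ∀ x : O, (f x : RatFunc K) = algebraMap K (RatFunc K) x := fun _ => rfl
  haveI : IsLocalHom f := ⟨fun x hx => by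
    rw [hwInt.isUnit_iff_valuation_eq_one] at hx
    rw [hvInt.isUnit_iff_valuation_eq_one]
    change w (f x : RatFunc K) = 1 at hx
    change v (x : K) = 1
    rwa [hf_apply, hwv] at hx⟩
  -- the induced map of residue fields is a surjective `k`-algebra homomorphism (normal form)
  let ψ : IsLocalRing.ResidueField O →ₐ[k] IsLocalRing.ResidueField O' :=
    IsLocalRing.ResidueField.mapAlgHom f
  have hψ : Function.Surjective ψ := by
    intro q
    obtain ⟨y, rfl⟩ := IsLocalRing.residue_surjective q
    obtain ⟨a, ha, hya⟩ := hnf y ((hwO' y).2 y.2)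
    refine ⟨IsLocalRing.residue O ⟨a, (hvO a).1 ha⟩, ?_⟩
    rw [IsLocalRing.ResidueField.mapAlgHom_residue, ← sub_eq_zero, ← map_sub,
      IsLocalRing.residue_eq_zero_iff, IsLocalRing.mem_maximalIdeal, mem_nonunits_iff,
      hwInt.isUnit_iff_valuation_eq_one, map_sub]
    change w ((f ⟨a, _⟩ : RatFunc K) - (y : RatFunc K)) ≠ 1
    rw [hf_apply, Valuation.map_sub_swap]
    exact hya.ne
  -- `k' = k(X)` is transcendental over `k`
  haveI : Algebra.Transcendental k k' := by
    obtain ⟨X', hX'⟩ : (RatFunc.X : RatFunc K) ∈ Set.range (algebraMap k' (RatFunc K)) := by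
      rw [hrange]
      exact IntermediateField.mem_adjoin_simple_self k _
    refine ⟨⟨X', ?_⟩⟩
    rw [← transcendental_algebraMap_iff (algebraMap k' (RatFunc K)).injective, hX']
    refine Transcendental.restrictScalars (S := K) (algebraMap k K).injective ?_
    rw [← RatFunc.algebraMap_X, transcendental_algebraMap_iff (RatFunc.algebraMap_injective K)]
    exact Polynomial.transcendental_X K
  exact residueTrdeg_drop_toNat_trdeg_lt ψ hψ hfin

end Summit.ResolutionOfSingularities.ResolutionOfSingularities.Theorems.SyzygyFlattening

end
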